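import Mathlib.LinearAlgebra.Matrix.NonsingularInverse
import Mathlib.LinearAlgebra.FiniteDimensional.Lemmas
import Mathlib.LinearAlgebra.LinearIndependent.Lemmas
import Mathlib.Data.ZMod.Basic
import Mathlib.FieldTheory.Finite.Basic
import Literature.Computability.QuantumComplexity.IQPForrelation

/-!
# Crux `CubicForrelation.NearExactIsExact` (stmt-QuantumAdvantage-14043) — ADAPTED FRAMES for `k` parity forms with a dual family

Certificate seat `b2b-cforr-cert` (gen 41).  HONEST FRAMING: kernel-checked linear algebra over `𝔽₂` (Mathlib; standard axioms) — the
generic tool (b) "adapted frame for `k` independent forms" of the Lean roadmap for `E1280-even` (HOME/b2b-cforr-cert-g40/LEAN-PLAN-E1280-EVEN.md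
§5), generalising …CubicFormFrame `tcr_adapted_frame` (two forms and a direction).  Uses: coordinates in which a light cell's cubic form
`t̄ = z ∧ B` becomes `s₀ ∧ ω_{2h}` (forms `z, B(bᵢ,·), B(cᵢ,·)` with dual family `v₀, cᵢ, bᵢ` from …CubicFormSymplecticKer), the R4 frame
(four forms), and the `T ⊕ T′` normal form of …KtThreeExceptionalStructure (six forms).  Nothing about `θ₁₂`; NOT summit progress.

* `tcg_extend`: a linearly independent family `Fin k → V` in a finite-dimensional space extends to `Fin (k + j)` for `k + j ≤ dim V`.
* `tcg_adapted_frame` (**main**): on `k + m` bits, given parity forms `z₀,…,z_{k−1}` with a DUAL FAMILY `u₀,…,u_{k−1}`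
  (`⟨uᵢ, z_{i'}⟩ = [i = i']`), there are matrices `P, Pi` over `𝔽₂` with `P Pi = Pi P = 1` such that for every bit vector `y` the vector
  `P y` (`(P y)_ψ = [Σ_φ P_{ψφ} y_φ = 1]`) satisfies `⟨P y, zᵢ⟩ = yᵢ` (coordinate `Fin.castAdd m i`).  Proof: the `𝔽₂`-images of the
  `zᵢ` are linearly independent (pair with the `uᵢ`); extend them to a basis, take it as the ROWS of `Q`, and put `P = Q⁻¹`.

References: folklore linear algebra; F. J. MacWilliams, N. J. A. Sloane (1977) Ch. 13 §4 (affine invariance of RM codes).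
Axioms: the standard three.
-/

set_option linter.dupNamespace false -- D-0017: single-problem summit ⇒ `QuantumAdvantage.QuantumAdvantage` by design

namespace Summit.QuantumAdvantage.QuantumAdvantage.Theorems.CubicForrelation.NearExactIsExact

open Finset Module
open Literature.Computability.QuantumComplexity.BuzetChailloux (zeroVec)

/-- **Extension of an independent family** in a finite-dimensional vector space: a linearly independent `v : Fin k → V` extends, for
`k + j ≤ dim V`, to a linearly independent `w : Fin (k + j) → V` with `w (castAdd j i) = v i`. [folklore] -/
theorem tcg_extend {K V : Type*} [Field K] [AddCommGroup V] [Module K V] [FiniteDimensional K V] {k : ℕ} (v : Fin k → V)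
    (hv : LinearIndependent K v) (j : ℕ) (h : k + j ≤ finrank K V) :
    ∃ w : Fin (k + j) → V, LinearIndependent K w ∧ ∀ i, w (Fin.castAdd j i) = v i := by
  induction j with
  | zero => exact ⟨v, hv, fun i => rfl⟩
  | succ j ih =>
    obtain ⟨w, hw, hwv⟩ := ih (by omega)
    have hlt : k + j < finrank K V := by omega
    obtain ⟨x, hx⟩ := exists_linearIndependent_snoc_of_lt_finrank hw hlt
    refine ⟨Fin.snoc w x, hx, fun i => ?_⟩
    have hc : (Fin.castAdd (j + 1) i : Fin (k + j + 1)) = (Fin.castAdd j i).castSucc := (Fin.castSucc_castAdd i).symm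
    rw [hc, Fin.snoc_castSucc]
    exact hwv i

/-- **Adapted frame for `k` parity forms with a dual family.**  See the module docstring. [folklore] -/
theorem tcg_adapted_frame {k m : ℕ} (z u : Fin k → (Fin (k + m) → Bool))
    (hdual : ∀ i i', decide (Odd #(univ.filter fun j => u i j && z i' j)) = decide (i = i')) :
    ∃ P Pi : Fin (k + m) → Fin (k + m) → ZMod 2,
      (∀ ψ ω, (∑ φ, P ψ φ * Pi φ ω) = if ψ = ω then 1 else 0) ∧
      (∀ ψ ω, (∑ φ, Pi ψ φ * P φ ω) = if ψ = ω then 1 else 0) ∧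
      (∀ (i : Fin k) (y : Fin (k + m) → Bool),
        decide (Odd #(univ.filter fun j =>
          (fun ψ => decide ((∑ φ, P ψ φ * (if y φ = true then (1 : ZMod 2) else 0)) = 1)) j && z i j)) = y (Fin.castAdd m i)) := by
  classical
  -- parities as dot products in `𝔽₂`
  have hpar : ∀ x w : Fin (k + m) → Bool, decide (Odd #(univ.filter fun j => x j && w j)) =
      decide ((∑ j, (if x j = true then (1 : ZMod 2) else 0) * (if w j = true then (1 : ZMod 2) else 0)) = 1) := by
    intro x w
    have hs : (∑ j, (if x j = true then (1 : ZMod 2) else 0) * (if w j = true then (1 : ZMod 2) else 0)) =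
        ((#(univ.filter fun j => x j && w j) : ℕ) : ZMod 2) := by
      rw [Finset.natCast_card_filter]
      refine sum_congr rfl fun j _ => ?_
      cases x j <;> cases w j <;> simp
    refine decide_eq_decide.mpr ?_
    rw [hs, ZMod.natCast_eq_one_iff_odd]
  -- the forms and the dual vectors in `𝔽₂^{k+m}`
  set ζ : Fin k → (Fin (k + m) → ZMod 2) := fun i j => if z i j = true then 1 else 0 with hζ
  set υ : Fin k → (Fin (k + m) → ZMod 2) := fun i j => if u i j = true then 1 else 0 with hυ
  have hpair : ∀ i i', (∑ j, υ i j * ζ i' j) = if i = i' then 1 else 0 := by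
    intro i i'
    have h := hdual i i'
    rw [hpar] at h
    have h01 : ∀ t : ZMod 2, ¬ t = 1 → t = 0 := by decide
    by_cases hi : i = i'
    · rw [if_pos hi]
      rw [decide_eq_true hi] at h
      exact of_decide_eq_true h
    · rw [if_neg hi]
      rw [decide_eq_false hi] at h
      exact h01 _ (of_decide_eq_false h)
  -- the forms are linearly independent
  have hli : LinearIndependent (ZMod 2) ζ := by
    rw [Fintype.linearIndependent_iff]
    intro g hg i
    have e := congrArg (fun v : Fin (k + m) → ZMod 2 => ∑ j, υ i j * v j) hg
    simp only [Finset.sum_apply, Pi.smul_apply, smul_eq_mul, Pi.zero_apply, mul_zero, sum_const_zero] at e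
    rw [show (∑ j, υ i j * ∑ c, g c * ζ c j) = ∑ c, g c * ∑ j, υ i j * ζ c j by
      simp only [mul_sum]; rw [sum_comm]; exact sum_congr rfl fun c _ => sum_congr rfl fun j _ => by ring] at e
    simp only [hpair, mul_ite, mul_one, mul_zero] at e
    rw [Finset.sum_ite_eq] at e
    simpa using e
  -- extend to a basis: the rows of `Q`
  have hdim : k + m ≤ finrank (ZMod 2) (Fin (k + m) → ZMod 2) := by rw [finrank_fin_fun]
  obtain ⟨q, hq, hqζ⟩ := tcg_extend ζ hli m hdim
  set Q : Matrix (Fin (k + m)) (Fin (k + m)) (ZMod 2) := Matrix.of fun ψ φ => q ψ φ with hQ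
  have hrow : Q.row = q := by funext ψ φ; rfl
  have hQu : IsUnit Q := Matrix.linearIndependent_rows_iff_isUnit.mp (by rw [hrow]; exact hq)
  have hdet : IsUnit Q.det := (Matrix.isUnit_iff_isUnit_det Q).mp hQu
  have hQQi : Q * Q⁻¹ = 1 := Matrix.mul_nonsing_inv Q hdet
  have hQiQ : Q⁻¹ * Q = 1 := Matrix.nonsing_inv_mul Q hdet
  refine ⟨fun ψ φ => Q⁻¹ ψ φ, fun ψ φ => Q ψ φ, fun ψ ω => ?_, fun ψ ω => ?_, fun i y => ?_⟩
  · have := congrFun (congrFun hQiQ ψ) ω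
    rw [Matrix.mul_apply, Matrix.one_apply] at this
    exact this
  · have := congrFun (congrFun hQQi ψ) ω
    rw [Matrix.mul_apply, Matrix.one_apply] at this
    exact this
  · -- `⟨Q⁻¹ y, zᵢ⟩ = (Q (Q⁻¹ y))ᵢ = yᵢ`
    rw [hpar]
    have hread : ∀ t : ZMod 2, (if decide (t = 1) = true then (1 : ZMod 2) else 0) = t := by decide
    simp only [hread]
    set y' : Fin (k + m) → ZMod 2 := fun φ => if y φ = true then 1 else 0 with hy'
    have hval : (∑ j, (∑ φ, Q⁻¹ j φ * y' φ) * ζ i j) = y' (Fin.castAdd m i) := by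
      have h1 : ∀ j, ζ i j = Q (Fin.castAdd m i) j := by
        intro j; rw [hQ, Matrix.of_apply, hqζ i]
      simp only [h1]
      have h2 : (∑ j, (∑ φ, Q⁻¹ j φ * y' φ) * Q (Fin.castAdd m i) j) = ((Q * Q⁻¹).mulVec y') (Fin.castAdd m i) := by
        rw [← Matrix.mulVec_mulVec]
        simp only [Matrix.mulVec, dotProduct]
        exact sum_congr rfl fun j _ => mul_comm _ _
      rw [h2, hQQi, Matrix.one_mulVec]
    have hval' : (∑ j, (∑ φ, Q⁻¹ j φ * (if y φ = true then (1 : ZMod 2) else 0)) * (if z i j = true then (1 : ZMod 2) else 0)) =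
        if y (Fin.castAdd m i) = true then 1 else 0 := hval
    rw [hval']
    cases y (Fin.castAdd m i) <;> decide

/-- **Adapted frame, target coordinates `castLE`.**  The same as `tcg_adapted_frame` on `N` bits with `k ≤ N` forms: the `i`-th form becomes
the coordinate `Fin.castLE hk i`. [folklore] -/
theorem tcg_adapted_frame_le {N k : ℕ} (hk : k ≤ N) (z u : Fin k → (Fin N → Bool))
    (hdual : ∀ i i', decide (Odd #(univ.filter fun j => u i j && z i' j)) = decide (i = i')) :
    ∃ P Pi : Fin N → Fin N → ZMod 2,
      (∀ ψ ω, (∑ φ, P ψ φ * Pi φ ω) = if ψ = ω then 1 else 0) ∧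
      (∀ ψ ω, (∑ φ, Pi ψ φ * P φ ω) = if ψ = ω then 1 else 0) ∧
      (∀ (i : Fin k) (y : Fin N → Bool),
        decide (Odd #(univ.filter fun j =>
          (fun ψ => decide ((∑ φ, P ψ φ * (if y φ = true then (1 : ZMod 2) else 0)) = 1)) j && z i j)) = y (Fin.castLE hk i)) := by
  obtain ⟨m, rfl⟩ : ∃ m, N = k + m := ⟨N - k, by omega⟩
  obtain ⟨P, Pi, h1, h2, h3⟩ := tcg_adapted_frame z u hdual
  refine ⟨P, Pi, h1, h2, fun i y => ?_⟩
  have hc : Fin.castLE hk i = Fin.castAdd m i := Fin.ext rfl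
  rw [hc]; exact h3 i y

/-- **A dual family bounds the number of forms**: parity forms `z₀,…,z_{k−1}` on `N` bits with a dual family are linearly independent,
so `k ≤ N` (the hypothesis `hk` of `tcg_adapted_frame_le`). [folklore] -/
theorem tcg_le_of_dual {N k : ℕ} (z u : Fin k → (Fin N → Bool))
    (hdual : ∀ i i', decide (Odd #(univ.filter fun j => u i j && z i' j)) = decide (i = i')) : k ≤ N := by
  classical
  have hpar : ∀ x w : Fin N → Bool, decide (Odd #(univ.filter fun j => x j && w j)) =
      decide ((∑ j, (if x j = true then (1 : ZMod 2) else 0) * (if w j = true then (1 : ZMod 2) else 0)) = 1) := by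
    intro x w
    have hs : (∑ j, (if x j = true then (1 : ZMod 2) else 0) * (if w j = true then (1 : ZMod 2) else 0)) =
        ((#(univ.filter fun j => x j && w j) : ℕ) : ZMod 2) := by
      rw [Finset.natCast_card_filter]
      refine sum_congr rfl fun j _ => ?_
      cases x j <;> cases w j <;> simp
    refine decide_eq_decide.mpr ?_
    rw [hs, ZMod.natCast_eq_one_iff_odd]
  set ζ : Fin k → (Fin N → ZMod 2) := fun i j => if z i j = true then 1 else 0 with hζ
  set υ : Fin k → (Fin N → ZMod 2) := fun i j => if u i j = true then 1 else 0 with hυ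
  have hpair : ∀ i i', (∑ j, υ i j * ζ i' j) = if i = i' then 1 else 0 := by
    intro i i'
    have h := hdual i i'
    rw [hpar] at h
    have h01 : ∀ t : ZMod 2, ¬ t = 1 → t = 0 := by decide
    by_cases hi : i = i'
    · rw [if_pos hi]
      rw [decide_eq_true hi] at h
      exact of_decide_eq_true h
    · rw [if_neg hi]
      rw [decide_eq_false hi] at h
      exact h01 _ (of_decide_eq_false h)
  have hli : LinearIndependent (ZMod 2) ζ := by
    rw [Fintype.linearIndependent_iff]
    intro g hg i
    have e := congrArg (fun v : Fin N → ZMod 2 => ∑ j, υ i j * v j) hg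
    simp only [Finset.sum_apply, Pi.smul_apply, smul_eq_mul, Pi.zero_apply, mul_zero, sum_const_zero] at e
    rw [show (∑ j, υ i j * ∑ c, g c * ζ c j) = ∑ c, g c * ∑ j, υ i j * ζ c j by
      simp only [mul_sum]; rw [sum_comm]; exact sum_congr rfl fun c _ => sum_congr rfl fun j _ => by ring] at e
    simp only [hpair, mul_ite, mul_one, mul_zero] at e
    rw [Finset.sum_ite_eq] at e
    simpa using e
  have := hli.fintype_card_le_finrank
  rw [finrank_fin_fun, Fintype.card_fin] at this
  exact this

/-- **Adapted frame with a direction column.**  On `N` bits let `z₀,…,z_{k−1}` be parity forms with a dual family `u₀,…,u_{k−1}` and let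
`a ≠ 0` be a direction with `⟨a, zᵢ⟩ = 0`.  Then `k + 1 ≤ N` and there are `P, Pi` over `𝔽₂` with `P Pi = Pi P = 1`, the LAST column of `P`
equal to `a`, and `⟨P y, zᵢ⟩ = yᵢ` for `i < k`.  (Rows of `Q = P⁻¹`: the `zᵢ`, extended to a basis of `a^⊥`, then a vector pairing to `1`
with `a`.)  Generalises …CubicFormFrame `tcr_adapted_frame` (`k = 2`, direction in column `0`); for the R4 frame. [folklore] -/
theorem tcg_adapted_frame_dir {N k : ℕ} (a : Fin N → Bool) (ha : a ≠ zeroVec) (z u : Fin k → (Fin N → Bool))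
    (hdual : ∀ i i', decide (Odd #(univ.filter fun j => u i j && z i' j)) = decide (i = i'))
    (haz : ∀ i, decide (Odd #(univ.filter fun j => a j && z i j)) = false) :
    ∃ (hk : k + 1 ≤ N) (P Pi : Fin N → Fin N → ZMod 2),
      (∀ ψ ω, (∑ φ, P ψ φ * Pi φ ω) = if ψ = ω then 1 else 0) ∧
      (∀ ψ ω, (∑ φ, Pi ψ φ * P φ ω) = if ψ = ω then 1 else 0) ∧
      (∀ ψ, P ψ ⟨N - 1, by omega⟩ = if a ψ = true then 1 else 0) ∧
      (∀ (i : Fin k) (y : Fin N → Bool),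
        decide (Odd #(univ.filter fun j =>
          (fun ψ => decide ((∑ φ, P ψ φ * (if y φ = true then (1 : ZMod 2) else 0)) = 1)) j && z i j)) =
          y (Fin.castLE (Nat.le_of_succ_le hk) i)) := by
  classical
  have hpar : ∀ x w : Fin N → Bool, decide (Odd #(univ.filter fun j => x j && w j)) =
      decide ((∑ j, (if x j = true then (1 : ZMod 2) else 0) * (if w j = true then (1 : ZMod 2) else 0)) = 1) := by
    intro x w
    have hs : (∑ j, (if x j = true then (1 : ZMod 2) else 0) * (if w j = true then (1 : ZMod 2) else 0)) =
        ((#(univ.filter fun j => x j && w j) : ℕ) : ZMod 2) := by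
      rw [Finset.natCast_card_filter]
      refine sum_congr rfl fun j _ => ?_
      cases x j <;> cases w j <;> simp
    refine decide_eq_decide.mpr ?_
    rw [hs, ZMod.natCast_eq_one_iff_odd]
  have h01 : ∀ t : ZMod 2, ¬ t = 1 → t = 0 := by decide
  set ζ : Fin k → (Fin N → ZMod 2) := fun i j => if z i j = true then 1 else 0 with hζ
  set υ : Fin k → (Fin N → ZMod 2) := fun i j => if u i j = true then 1 else 0 with hυ
  set a' : Fin N → ZMod 2 := fun j => if a j = true then 1 else 0 with ha'
  have hpair : ∀ i i', (∑ j, υ i j * ζ i' j) = if i = i' then 1 else 0 := by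
    intro i i'
    have h := hdual i i'
    rw [hpar] at h
    by_cases hi : i = i'
    · rw [if_pos hi]; rw [decide_eq_true hi] at h; exact of_decide_eq_true h
    · rw [if_neg hi]; rw [decide_eq_false hi] at h; exact h01 _ (of_decide_eq_false h)
  have haζ : ∀ i, (∑ j, a' j * ζ i j) = 0 := by
    intro i
    have h := haz i
    rw [hpar] at h
    exact h01 _ (of_decide_eq_false h)
  have hli : LinearIndependent (ZMod 2) ζ := by
    rw [Fintype.linearIndependent_iff]
    intro g hg i
    have e := congrArg (fun v : Fin N → ZMod 2 => ∑ j, υ i j * v j) hg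
    simp only [Finset.sum_apply, Pi.smul_apply, smul_eq_mul, Pi.zero_apply, mul_zero, sum_const_zero] at e
    rw [show (∑ j, υ i j * ∑ c, g c * ζ c j) = ∑ c, g c * ∑ j, υ i j * ζ c j by
      simp only [mul_sum]; rw [sum_comm]; exact sum_congr rfl fun c _ => sum_congr rfl fun j _ => by ring] at e
    simp only [hpair, mul_ite, mul_one, mul_zero] at e
    rw [Finset.sum_ite_eq] at e
    simpa using e
  -- the functional `x ↦ ⟨x, a⟩` and its kernel
  set φa : (Fin N → ZMod 2) →ₗ[ZMod 2] ZMod 2 := ∑ j, a' j • LinearMap.proj j with hφa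
  have hφa' : ∀ x, φa x = ∑ j, a' j * x j := by
    intro x; rw [hφa, LinearMap.sum_apply]; simp only [LinearMap.smul_apply, LinearMap.proj_apply, smul_eq_mul]
  obtain ⟨j₀, hj₀⟩ : ∃ j₀, a j₀ = true := by
    by_contra hno; push Not at hno
    exact ha (funext fun i => by simpa [zeroVec] using hno i)
  have hsurj : LinearMap.range φa = ⊤ := by
    rw [LinearMap.range_eq_top]
    intro t
    refine ⟨fun j => if j = j₀ then t else 0, ?_⟩
    rw [hφa']
    simp only [mul_ite, mul_zero, sum_ite_eq', mem_univ, if_true, ha', hj₀, if_true, one_mul]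
  have hker : finrank (ZMod 2) (LinearMap.ker φa) = N - 1 := by
    have e := LinearMap.finrank_range_add_finrank_ker φa
    rw [hsurj, finrank_top, Module.finrank_self, finrank_fin_fun] at e
    omega
  have hζker : ∀ i, ζ i ∈ LinearMap.ker φa := by
    intro i; rw [LinearMap.mem_ker, hφa']; exact haζ i
  set ζH : Fin k → LinearMap.ker φa := fun i => ⟨ζ i, hζker i⟩ with hζH
  have hliH : LinearIndependent (ZMod 2) ζH :=
    LinearIndependent.of_comp (LinearMap.ker φa).subtype (by simpa [hζH, Function.comp_def] using hli)
  have hkN : k ≤ N - 1 := by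
    have := hliH.fintype_card_le_finrank
    rwa [Fintype.card_fin, hker] at this
  have hN : 0 < N := Fin.pos j₀
  obtain ⟨m, rfl⟩ : ∃ m, N = k + m + 1 := ⟨N - k - 1, by omega⟩
  -- extend inside the kernel, then add a vector pairing to `1` with `a`
  obtain ⟨w, hw, hwζ⟩ := tcg_extend ζH hliH m (by rw [hker]; omega)
  set u₀ : Fin (k + m + 1) → ZMod 2 := fun j => if j = j₀ then 1 else 0 with hu₀
  have hu₀a : φa u₀ = 1 := by
    rw [hφa']; simp only [hu₀, mul_ite, mul_one, mul_zero, sum_ite_eq', mem_univ, if_true, ha', hj₀, if_true]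
  have hwV : LinearIndependent (ZMod 2) (fun t => ((w t : LinearMap.ker φa) : Fin (k + m + 1) → ZMod 2)) :=
    hw.map' (LinearMap.ker φa).subtype (Submodule.ker_subtype _)
  have hu₀span : u₀ ∉ Submodule.span (ZMod 2) (Set.range fun t => ((w t : LinearMap.ker φa) : Fin (k + m + 1) → ZMod 2)) := by
    intro hmem
    have hsub : Submodule.span (ZMod 2) (Set.range fun t => ((w t : LinearMap.ker φa) : Fin (k + m + 1) → ZMod 2)) ≤
        LinearMap.ker φa := Submodule.span_le.mpr (Set.range_subset_iff.2 fun t => (w t).2)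
    have : u₀ ∈ LinearMap.ker φa := hsub hmem
    rw [LinearMap.mem_ker, hu₀a] at this
    exact one_ne_zero this
  set q : Fin (k + m + 1) → (Fin (k + m + 1) → ZMod 2) :=
    Fin.snoc (fun t => ((w t : LinearMap.ker φa) : Fin (k + m + 1) → ZMod 2)) u₀ with hq
  have hqli : LinearIndependent (ZMod 2) q := hwV.finSnoc hu₀span
  have hqζ : ∀ i : Fin k, q (Fin.castSucc (Fin.castAdd m i)) = ζ i := by
    intro i; rw [hq, Fin.snoc_castSucc]; simp only [hwζ i, hζH]
  have hqa : ∀ ψ, (∑ φ, q ψ φ * a' φ) = if ψ = Fin.last (k + m) then 1 else 0 := by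
    intro ψ
    have e : (∑ φ, q ψ φ * a' φ) = φa (q ψ) := by rw [hφa']; exact sum_congr rfl fun φ _ => mul_comm _ _
    rw [e]
    rcases Fin.eq_castSucc_or_eq_last ψ with ⟨t, rfl⟩ | rfl
    · rw [hq, Fin.snoc_castSucc, if_neg (Fin.castSucc_lt_last t).ne]
      exact (w t).2
    · rw [hq, Fin.snoc_last, if_pos rfl]; exact hu₀a
  -- the matrices
  set Q : Matrix (Fin (k + m + 1)) (Fin (k + m + 1)) (ZMod 2) := Matrix.of fun ψ φ => q ψ φ with hQ
  have hrow : Q.row = q := by funext ψ φ; rfl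
  have hQu : IsUnit Q := Matrix.linearIndependent_rows_iff_isUnit.mp (by rw [hrow]; exact hqli)
  have hdet : IsUnit Q.det := (Matrix.isUnit_iff_isUnit_det Q).mp hQu
  have hQQi : Q * Q⁻¹ = 1 := Matrix.mul_nonsing_inv Q hdet
  have hQiQ : Q⁻¹ * Q = 1 := Matrix.nonsing_inv_mul Q hdet
  have hk : k + 1 ≤ k + m + 1 := by omega
  refine ⟨hk, fun ψ φ => Q⁻¹ ψ φ, fun ψ φ => Q ψ φ, fun ψ ω => ?_, fun ψ ω => ?_, fun ψ => ?_, fun i y => ?_⟩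
  · have := congrFun (congrFun hQiQ ψ) ω
    rw [Matrix.mul_apply, Matrix.one_apply] at this
    exact this
  · have := congrFun (congrFun hQQi ψ) ω
    rw [Matrix.mul_apply, Matrix.one_apply] at this
    exact this
  · -- the last column of `Q⁻¹` is `a`: `Q a = e_last`
    have hQa : Q.mulVec a' = Pi.single (Fin.last (k + m)) 1 := by
      funext ψ
      rw [Matrix.mulVec, dotProduct]
      show (∑ φ, q ψ φ * a' φ) = _
      rw [hqa, Pi.single_apply]
    have e : Q⁻¹.mulVec (Q.mulVec a') = a' := by rw [Matrix.mulVec_mulVec, hQiQ, Matrix.one_mulVec]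
    rw [hQa, Matrix.mulVec_single_one] at e
    have hlast : (⟨k + m + 1 - 1, by omega⟩ : Fin (k + m + 1)) = Fin.last (k + m) := Fin.ext (by simp)
    rw [hlast]
    have := congrFun e ψ
    exact this
  · rw [hpar]
    have hread : ∀ t : ZMod 2, (if decide (t = 1) = true then (1 : ZMod 2) else 0) = t := by decide
    simp only [hread]
    set y' : Fin (k + m + 1) → ZMod 2 := fun φ => if y φ = true then 1 else 0 with hy'
    have hval : (∑ j, (∑ φ, Q⁻¹ j φ * y' φ) * ζ i j) = y' (Fin.castSucc (Fin.castAdd m i)) := by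
      have h1 : ∀ j, ζ i j = Q (Fin.castSucc (Fin.castAdd m i)) j := by
        intro j; rw [hQ, Matrix.of_apply, hqζ i]
      simp only [h1]
      have h2 : (∑ j, (∑ φ, Q⁻¹ j φ * y' φ) * Q (Fin.castSucc (Fin.castAdd m i)) j) =
          ((Q * Q⁻¹).mulVec y') (Fin.castSucc (Fin.castAdd m i)) := by
        rw [← Matrix.mulVec_mulVec]
        simp only [Matrix.mulVec, dotProduct]
        exact sum_congr rfl fun j _ => mul_comm _ _
      rw [h2, hQQi, Matrix.one_mulVec]
    have hval' : (∑ j, (∑ φ, Q⁻¹ j φ * (if y φ = true then (1 : ZMod 2) else 0)) * (if z i j = true then (1 : ZMod 2) else 0)) =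
        if y (Fin.castSucc (Fin.castAdd m i)) = true then 1 else 0 := hval
    rw [hval']
    have hidx : Fin.castLE (Nat.le_of_succ_le hk) i = Fin.castSucc (Fin.castAdd m i) := Fin.ext rfl
    rw [hidx]
    cases y (Fin.castSucc (Fin.castAdd m i)) <;> decide

end Summit.QuantumAdvantage.QuantumAdvantage.Theorems.CubicForrelation.NearExactIsExact
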